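import Literature.AlgebraicGeometry.Surfaces.K3MarkingProofs

/-!
# Route NikulinTwinTransport · `RealMultiplicationGlue` (stmt-HodgeConjecture-13681) —
# an integral basis of `H²(S(ℂ); ℂ)` with its Gram matrix, for ANY smooth projective surface

Helper file (supports stmt-HodgeConjecture-13681). The glue item `RealMultiplicationGlue` was
reduced by earlier seats to the marking fact `Huybrechts_K3_marking_exists`
(`H²(S, ℤ) ≅ Λ_{K3}` with the cup form; `realMultiplicationGlue_of_marking`). The marking enters
that proof in two logically different ways: (a) as a COORDINATE SYSTEM in which rational classes
are the rational vectors and the cup product is a lattice form — pure bookkeeping —, and (b)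
through the one genuinely missing input, the existence of a rational `2`-similitude of
`(H²(S, ℚ), ∪)` (Witt). This file supplies (a) UNCONDITIONALLY, for every smooth projective
surface `S` over `ℂ`, by the lattice theory already proved in the tree (Huybrechts, *Lectures on
K3 Surfaces*, Ch. 1 §3.2–3.3, p. 22–24: "`H²(X, ℤ)` is a free abelian group … the intersection
form … (modulo torsion) defines a unimodular lattice"; Hatcher Thm. 3.2, Prop. 3.38 / Cor. 3.39):

* `exists_integralBasis` — for a `ℤ`-orientation `μ` of `S(ℂ)` there are classes
  `e i ∈ H²(S(ℂ); ℤ)`, `i : Fin n`, whose images `e i ⊗ 1` form a `ℂ`-basis of `H²(S(ℂ); ℂ)`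
  containing the image of `H²(S(ℂ); ℤ)` in its `ℤ`-span, with a SYMMETRIC UNIMODULAR Gram matrix
  `G i j = ⟨e i ∪ e j, [S(ℂ)]_μ⟩` (any `ℤ`-basis of `H²/T`; `exists_latticeBasis_of_isEven_of_signature`
  of `K3MarkingProofs.lean` without Milnor's theorem);
* `exists_integralMarking` — hence a coordinate isomorphism `η : H²(S(ℂ); ℂ) ≅ ℂⁿ`, an
  integral generator `p ≠ 0` of `H⁴(S(ℂ); ℂ)` and a symmetric integer matrix `G` with `det G = ±1`
  such that the integral classes are exactly `η⁻¹(ℤⁿ)` and `a ∪ b = (ηa)ᵀ G (ηb) • p`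
  (`marking_of_latticeBasis` without the Hodge data).

Everything is proved; no named fact is introduced. Prover seat prover-pitem-stmt-HodgeConjecture-13681-2.
-/

noncomputable section

namespace Summit.HodgeConjecture.HodgeConjecture.Theorems.NikulinTwinTransport

open CategoryTheory Module
open LinearMap (BilinForm)
open Literature.AlgebraicGeometry Literature.AlgebraicGeometry.Motives
open Literature.AlgebraicGeometry.HodgeTheory Literature.AlgebraicGeometry.Surfaces
open Literature.AlgebraicTopology.SingularHomology Literature.Topology.FourManifolds

variable {S : SchemeOver ℂ}

/-- **An integral basis of `H²(S(ℂ); ℂ)` with symmetric unimodular Gram matrix.** For `S` smooth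
projective of dimension `2` and a `ℤ`-orientation `μ` of `S(ℂ)` there are `n : ℕ` and classes
`e i ∈ H²(S(ℂ); ℤ)`, `i : Fin n`, such that the `e i ⊗ 1` are `ℂ`-linearly independent (`hli`) and
span `H²(S(ℂ); ℂ)` (`hsp`), every integral class is an integral combination of them over `ℂ`
(`hlat`), and the Gram matrix `G i j = ⟨e i ∪ e j, [S(ℂ)]_μ⟩` is symmetric with `det G` a unit.
Proof (Huybrechts p. 24, Hatcher Prop. 3.38 / Cor. 3.39): the intersection form on the finite
free `H²(S(ℂ); ℤ)/T` is symmetric (`isSymm_intersectionForm`) and unimodular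
(`isPerfPair_intersectionForm`, Poincaré duality); take ANY `ℤ`-basis of `H²/T`
(`Module.finBasis`), lift it to `H²(S(ℂ); ℤ)`, and argue as in
`exists_latticeBasis_of_isEven_of_signature`: torsion dies over `ℂ`, a rational relation is an
integral relation modulo torsion, and `n = rank H²/T = b₂ = dim_ℂ H²(S(ℂ); ℂ)`.
[cite: Huybrechts2016K3, Ch. 1 §3.2–3.3 (p. 22–24)] [cite: HatcherAT2002, §3.1 Thm. 3.2, Cor. 3.3; §3.3 Prop. 3.38, Cor. 3.39] -/
theorem exists_integralBasis (hS : IsSmoothProjective 2 S)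
    (μ : HomologicalOrientation ℤ (ComplexPoints S) (2 * 2)) :
    ∃ (n : ℕ) (e : Fin n → singularCohomology ℤ ℤ (ComplexPoints S) (2 * 1))
      (G : Matrix (Fin n) (Fin n) ℤ),
      LinearIndependent ℂ (fun i => singularCohomology.ringChange (algebraMap ℤ ℂ) (ComplexPoints S) (2 * 1) (e i)) ∧
      ⊤ ≤ Submodule.span ℂ (Set.range fun i => singularCohomology.ringChange (algebraMap ℤ ℂ) (ComplexPoints S) (2 * 1) (e i)) ∧
      (∀ y : singularCohomology ℤ ℤ (ComplexPoints S) (2 * 1),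
        ∃ v : Fin n → ℤ, singularCohomology.ringChange (algebraMap ℤ ℂ) (ComplexPoints S) (2 * 1) y =
          ∑ i, (v i : ℂ) • singularCohomology.ringChange (algebraMap ℤ ℂ) (ComplexPoints S) (2 * 1) (e i)) ∧
      (∀ i j, kroneckerPairing ℤ ℤ (ComplexPoints S) (2 * 2)
        (cupProduct (rfl : 2 * 1 + 2 * 1 = 2 * 2) (e i) (e j)) μ.fundamentalClass = G i j) ∧
      G.transpose = G ∧ IsUnit G.det := by
  letI := hS.chartedSpace
  haveI := ComplexPoints.compactSpace_of_isSmoothProjective hS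
  haveI := ComplexPoints.t2Space_of_isSmoothProjective hS
  set rc := singularCohomology.ringChange (algebraMap ℤ ℂ) (ComplexPoints S) (2 * 1) with hrc
  set Q := intersectionForm (rfl : 2 * 1 + 2 * 1 = 2 * 2) μ with hQ
  -- `H²(S(ℂ); ℤ)/T` is finite free; `Q` is symmetric and unimodular
  have hF := finite_singularCohomology_of_compactSpace_of_isPrincipalIdealRing ℤ
    (ComplexPoints S) (2 * 2) (2 * 1)
  haveI : Module.Finite ℤ (freeCohomology ℤ (ComplexPoints S) (2 * 1)) := finite_freeCohomology hF
  haveI : Module.Free ℤ (freeCohomology ℤ (ComplexPoints S) (2 * 1)) := free_freeCohomology hF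
  have hQs : Q.IsSymm :=
    isSymm_intersectionForm (cupProduct_gradedComm_holds ℤ _) ⟨1, rfl⟩ _ μ
  have hQu : Q.IsUnimodular :=
    isPerfPair_intersectionForm _ μ isPerfPair_cupPairingModTorsion_holds
  -- rank `n = b₂ = dim_ℂ H²(S(ℂ); ℂ)`
  set n := finrank ℤ (freeCohomology ℤ (ComplexPoints S) (2 * 1)) with hn
  have hdim : finrank ℂ (complexBetti S (2 * 1)) = n := by
    have h1 : finrank ℤ (freeCohomology ℤ (ComplexPoints S) (2 * 1)) =
        bettiNumber ℚ (ComplexPoints S) (2 * 1) :=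
      finrank_freeCohomology_eq_bettiNumber_holds (n := 2 * 2) (2 * 1)
    rw [hn, h1, bettiNumber_rat_eq_real, bettiNumber_real_eq_complex,
      ← finrank_singularCohomology_eq_bettiNumber_of_field]
  -- any `ℤ`-basis of `H²/T`, its Gram matrix, and lifts `e i`
  let bV : Module.Basis (Fin n) ℤ (freeCohomology ℤ (ComplexPoints S) (2 * 1)) := Module.finBasis ℤ _
  set G : Matrix (Fin n) (Fin n) ℤ := Matrix.of fun i j => Q (bV i) (bV j) with hG
  choose e he using fun i => freeCohomology.mk_surjective (bV i)
  -- (hGram)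
  have hGram : ∀ i j, kroneckerPairing ℤ ℤ (ComplexPoints S) (2 * 2)
      (cupProduct (rfl : 2 * 1 + 2 * 1 = 2 * 2) (e i) (e j)) μ.fundamentalClass = G i j :=
    fun i j => by rw [← cupPairing_apply, ← intersectionForm_mk_mk, he, he, hG, Matrix.of_apply]
  -- (symmetry and unimodularity of `G`)
  have hGt : G.transpose = G := by
    ext i j
    rw [Matrix.transpose_apply, hG, Matrix.of_apply, Matrix.of_apply, hQs.eq]
  have hGdet : IsUnit G.det := by
    have h1 := (LinearMap.BilinForm.isUnimodular_iff_isUnit_det_holds Q bV).1 hQu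
    have h2 : LinearMap.BilinForm.toMatrix bV Q = G := by
      ext i j
      rw [LinearMap.BilinForm.toMatrix_apply, hG, Matrix.of_apply]
    rwa [h2] at h1
  -- (hlat) every integral class is an integral combination of the `e i`, modulo torsion
  have hlat : ∀ y : singularCohomology ℤ ℤ (ComplexPoints S) (2 * 1),
      ∃ v : Fin n → ℤ, rc y = ∑ i, (v i : ℂ) • rc (e i) := fun y => by
    refine ⟨fun i => bV.repr (freeCohomology.mk y) i, ?_⟩
    have hy : ∑ i, (bV.repr (freeCohomology.mk y) i) • bV i = freeCohomology.mk y := by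
      conv_rhs => rw [← bV.sum_repr (freeCohomology.mk y)]
      exact Finset.sum_congr rfl fun i _ => (int_smul_eq_zsmul _ _ _).symm
    have htor : y - ∑ i, (bV.repr (freeCohomology.mk y) i) • e i ∈
        Submodule.torsion ℤ (singularCohomology ℤ ℤ (ComplexPoints S) (2 * 1)) := by
      rw [← freeCohomology.mk_eq_zero_iff, map_sub, map_sum, sub_eq_zero, ← hy]
      simp_rw [map_zsmul, he, hy]
    have h0 := ringChange_eq_zero_of_mem_torsion htor
    rw [map_sub, sub_eq_zero, map_sum] at h0
    rw [hrc, h0]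
    exact Finset.sum_congr rfl fun i _ => by rw [map_zsmul, Int.cast_smul_eq_zsmul]
  -- (hli) a rational relation, cleared of denominators, is an integral relation modulo torsion
  have hli : LinearIndependent ℂ fun i => rc (e i) := by
    refine HodgeTheory.linearIndependent_of_isRationalClass
      (fun i => (isIntegralClass_ringChange_int (e i)).isRationalClass) fun q hq => ?_
    obtain ⟨⟨D, hD⟩, hDq⟩ := IsLocalization.exist_integer_multiples_of_finite (nonZeroDivisors ℤ) q
    choose m hm using hDq
    have hm0 : ∑ i, (m i : ℂ) • rc (e i) = 0 := by
      have h1 : ∑ i, (m i : ℂ) • rc (e i) = (D : ℂ) • ∑ i, ((q i : ℚ) : ℂ) • rc (e i) := by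
        rw [Finset.smul_sum]
        refine Finset.sum_congr rfl fun i _ => ?_
        rw [smul_smul]
        congr 1
        have h2 : ((m i : ℚ) : ℂ) = (((D : ℤ) • q i : ℚ) : ℂ) := by
          rw [← hm i]; simp
        rw [zsmul_eq_mul, Rat.cast_mul, Rat.cast_intCast] at h2
        exact_mod_cast h2
      rw [h1, hq, smul_zero]
    have hsum : rc (∑ i, m i • e i) = 0 := by
      rw [← hm0, map_sum]
      exact Finset.sum_congr rfl fun i _ => by rw [map_zsmul, Int.cast_smul_eq_zsmul]
    have htor := mem_torsion_of_ringChange_eq_zero (d := 2 * 2) 1 hsum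
    have hrel : ∑ i, m i • bV i = 0 := by
      have h1 : freeCohomology.mk (∑ i, m i • e i) = 0 := (freeCohomology.mk_eq_zero_iff _).2 htor
      rw [map_sum] at h1
      rw [← h1]
      exact Finset.sum_congr rfl fun i _ => by rw [map_zsmul, he]
    have hm' : ∀ i, m i = 0 := fun i =>
      Fintype.linearIndependent_iff.1 bV.linearIndependent m
        ((Finset.sum_congr rfl fun i _ => (int_smul_eq_zsmul _ _ _)).trans hrel) i
    funext i
    have h3 := hm i
    rw [hm' i, map_zero] at h3
    have hD0 : (D : ℤ) ≠ 0 := nonZeroDivisors.ne_zero hD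
    rw [zsmul_eq_mul] at h3
    have hqi : q i = 0 := (mul_eq_zero.1 h3.symm).resolve_left (by exact_mod_cast hD0)
    rw [hqi, Pi.zero_apply]
  -- (hsp) `n` independent vectors in the `n`-dimensional `H²(S(ℂ); ℂ)` span it
  haveI : Module.Finite ℂ (complexBetti S (2 * 1)) :=
    finite_singularCohomology_of_compact_chartedSpace ℂ ℂ (d := 2 * 2) (2 * 1)
  have hsp : ⊤ ≤ Submodule.span ℂ (Set.range fun i => rc (e i)) := by
    rw [top_le_iff]
    apply Submodule.eq_top_of_finrank_eq
    rw [finrank_span_eq_card hli, Fintype.card_fin]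
    exact hdim.symm
  exact ⟨n, e, G, hli, hsp, hlat, hGram, hGt, hGdet⟩

/-- **An integral marking of `H²(S(ℂ); ℂ)` with its Gram matrix, for every smooth projective
surface.** For `S` smooth projective of dimension `2` there are `n : ℕ`, a `ℂ`-linear isomorphism
`η : H²(S(ℂ); ℂ) ≅ ℂⁿ`, a symmetric integer matrix `G` with `det G = ±1` and a class
`p ∈ H⁴(S(ℂ); ℂ)` with: `p ≠ 0`, `p` integral, every integral class of `H⁴` an integer multiple of
`p`; the integral classes of `H²` are exactly `η⁻¹(ℤⁿ)`; and `a ∪ b = ((ηa)ᵀ G (ηb)) • p`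
(`Matrix.toBilin'`). Proof: `η` is the coordinate map of the basis `e i ⊗ 1` of
`exists_integralBasis` (for the `ℤ`-orientation of `Motives.ComplexPoints.isOrientableOver`),
`p = g ⊗ 1` for the Kronecker dual `g` of the fundamental class
(`exists_integral_orientation_generator_top`), and the cup product is computed on the basis, where
`(e i ∪ e j) ⊗ 1 = ⟨e i ∪ e j, [S(ℂ)]⟩ • p = G i j • p` — clauses (C) and (D) of
`marking_of_latticeBasis`, verbatim. (For a K3 surface `G ≅ Λ_{K3}`, Huybrechts Ch. 1 Prop. 3.5;
that identification is NOT used or claimed here.)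
[cite: Huybrechts2016K3, Ch. 1 §3.2–3.3 (p. 22–24)] [cite: HatcherAT2002, §3.1 Thm. 3.2; §3.3 Thm. 3.30, Prop. 3.38] -/
theorem exists_integralMarking (hS : IsSmoothProjective 2 S) :
    ∃ (n : ℕ) (η : complexBetti S (2 * 1) ≃ₗ[ℂ] (Fin n → ℂ)) (G : Matrix (Fin n) (Fin n) ℤ)
      (p : complexBetti S (2 * 2)),
      p ≠ 0 ∧ IsIntegralClass p ∧
      (∀ q : complexBetti S (2 * 2), IsIntegralClass q → ∃ m : ℤ, q = m • p) ∧
      G.transpose = G ∧ IsUnit G.det ∧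
      (∀ c : complexBetti S (2 * 1), IsIntegralClass c ↔ ∃ v : Fin n → ℤ, η c = fun i => (v i : ℂ)) ∧
      ∀ a b : complexBetti S (2 * 1),
        cupProduct (rfl : 2 * 1 + 2 * 1 = 2 * 2) a b =
          Matrix.toBilin' (G.map (Int.cast : ℤ → ℂ)) (η a) (η b) • p := by
  obtain ⟨μ⟩ := ComplexPoints.isOrientableOver ℤ hS
  -- the integral generator `g` of `H⁴(S(ℂ); ℤ)` dual to `[S(ℂ)]_μ`, and `p = g ⊗ 1`
  obtain ⟨g, hg1, hgenZ, hne, hint, hgenC⟩ := exists_integral_orientation_generator_top hS μ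
  obtain ⟨n, e, G, hli, hsp, hlat, hGram, hGt, hGdet⟩ := exists_integralBasis hS μ
  -- the basis `b i = e i ⊗ 1` of `H²(S(ℂ); ℂ)` and the coordinate isomorphism `η`
  obtain ⟨b, hb⟩ : ∃ b : Module.Basis (Fin n) ℂ (complexBetti S (2 * 1)),
      ∀ i, b i = (singularCohomology.ringChange (algebraMap ℤ ℂ) (ComplexPoints S) (2 * 1)) (e i) :=
    ⟨Module.Basis.mk hli hsp, fun i => Module.Basis.mk_apply hli hsp i⟩
  obtain ⟨η, hηsymm, hηb⟩ : ∃ η : complexBetti S (2 * 1) ≃ₗ[ℂ] (Fin n → ℂ),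
      (∀ w : Fin n → ℂ, η.symm w = ∑ i, w i • b i) ∧ ∀ i, η (b i) = Pi.single i 1 :=
    ⟨b.equivFun, fun w => b.equivFun_symm_apply w, fun i => by
      rw [Module.Basis.equivFun_apply, Module.Basis.repr_self, Finsupp.single_eq_pi_single]⟩
  -- integral coordinate vectors
  have hηint : ∀ v : Fin n → ℤ, η.symm (fun i => (v i : ℂ)) =
      (singularCohomology.ringChange (algebraMap ℤ ℂ) (ComplexPoints S) (2 * 1)) (∑ i, v i • e i) :=
    fun v => by
    rw [hηsymm, map_sum]
    exact Finset.sum_congr rfl fun i _ => by rw [hb, map_zsmul, Int.cast_smul_eq_zsmul]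
  have hηlat : ∀ y : singularCohomology ℤ ℤ (ComplexPoints S) (2 * 1),
      ∃ v : Fin n → ℤ, η ((singularCohomology.ringChange (algebraMap ℤ ℂ) (ComplexPoints S) (2 * 1)) y) =
        fun i => (v i : ℂ) := fun y => by
    obtain ⟨v, hv⟩ := hlat y
    refine ⟨v, ?_⟩
    have : (singularCohomology.ringChange (algebraMap ℤ ℂ) (ComplexPoints S) (2 * 1)) y =
        η.symm (fun i => (v i : ℂ)) := by
      rw [hv, hηsymm]; exact Finset.sum_congr rfl fun i _ => by rw [hb]
    rw [this, LinearEquiv.apply_symm_apply]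
  -- (C) integral classes are the classes with integral coordinates
  have hC : ∀ c : complexBetti S (2 * 1),
      IsIntegralClass c ↔ ∃ v : Fin n → ℤ, η c = fun i => (v i : ℂ) := by
    intro c
    constructor
    · intro hc
      obtain ⟨y, rfl⟩ := hc.exists_ringChange_int_eq
      exact hηlat y
    · rintro ⟨v, hv⟩
      have : c = η.symm (fun i => (v i : ℂ)) := by rw [← hv, LinearEquiv.symm_apply_apply]
      rw [this, hηint]
      exact isIntegralClass_ringChange_int _
  -- cup products of basis vectors: `b i ∪ b j = (e i ∪ e j) ⊗ 1 = G i j • p`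
  have hcupb : ∀ i j, cupProduct (rfl : 2 * 1 + 2 * 1 = 2 * 2) (b i) (b j) =
      (G i j : ℂ) • (singularCohomology.ringChange (algebraMap ℤ ℂ) (ComplexPoints S) (2 * 2)) g :=
    fun i j => by
    rw [hb, hb, ← singularCohomology.ringChange_cupProduct (algebraMap ℤ ℂ) rfl (e i) (e j),
      hgenZ (cupProduct rfl (e i) (e j)), hGram i j, map_zsmul, Int.cast_smul_eq_zsmul]
  -- (D) the cup product is the Gram form in coordinates, times `p` (bilinear extension)
  set Gc : Matrix (Fin n) (Fin n) ℂ := G.map (Int.cast : ℤ → ℂ) with hGc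
  obtain ⟨B, hB⟩ : ∃ B : complexBetti S (2 * 1) →ₗ[ℂ] complexBetti S (2 * 1) →ₗ[ℂ]
      complexBetti S (2 * 2), ∀ a c, B a c =
        Matrix.toBilin' Gc (η a) (η c) • (singularCohomology.ringChange (algebraMap ℤ ℂ) (ComplexPoints S) (2 * 2)) g :=
    ⟨LinearMap.mk₂ ℂ (fun a c => Matrix.toBilin' Gc (η a) (η c) •
          (singularCohomology.ringChange (algebraMap ℤ ℂ) (ComplexPoints S) (2 * 2)) g)
        (fun a a' c => by rw [map_add, map_add, LinearMap.add_apply, add_smul])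
        (fun t a c => by rw [map_smul, map_smul, LinearMap.smul_apply, smul_eq_mul, mul_smul])
        (fun a c c' => by rw [map_add, map_add, add_smul])
        (fun t a c => by rw [map_smul, map_smul, smul_eq_mul, mul_smul]),
      fun a c => rfl⟩
  have hBeq : cupProduct (rfl : 2 * 1 + 2 * 1 = 2 * 2) = B :=
    b.ext fun i => b.ext fun j => by
      rw [hB, hcupb, hηb, hηb, Matrix.toBilin'_single, hGc, Matrix.map_apply]
  have hD : ∀ a c : complexBetti S (2 * 1), cupProduct (rfl : 2 * 1 + 2 * 1 = 2 * 2) a c =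
      Matrix.toBilin' Gc (η a) (η c) • (singularCohomology.ringChange (algebraMap ℤ ℂ) (ComplexPoints S) (2 * 2)) g :=
    fun a c => by rw [hBeq, hB]
  exact ⟨n, η, G, _, hne, hint, hgenC, hGt, hGdet, hC, hD⟩

end Summit.HodgeConjecture.HodgeConjecture.Theorems.NikulinTwinTransport

end
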